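import Mathlib
import HarnessLib

/-!
# Gluing consistent conditionals on an exhausting increasing family of events

Crux `AxiomsOfLimit` (stmt-CriticalPhenomena-1370), line `registered`, stub `stub_markovOfLimit`: restriction-built kernel,
brick 1 (lead c4). Registered sub-goal stub `stub_gluingConsistentConditionals`. Pure measure theory (theorems only).

Setting: a measurable space `X`, an increasing sequence of measurable events `E n`, probability measures `μ n` carried by
`E n` which are CONSISTENT CONDITIONALS of each other, `μ n T * μ m (E n) = μ m (T ∩ E n)` for `n ≤ m` (that is,
`μ n = μ m (· | E n)`), and EXHAUSTING, `1 - ε ≤ μ m (E n)` for all `m ≥ n ≥ n₀(ε)`. Conclusion: there is a unique probability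
measure `ν` carried by `⋃ n, E n` with `μ n = ν (· | E n)` for every `n`, in the product form
`μ n T * ν (E n) = ν (T ∩ E n)`.

In the crux this is the abstract gluing step of the canonical candidate for the domain-Markov kernel `Q D p`: for pinned
Jordan sub-domains `D'_n ↑` the slit domain, restriction covariance makes `μ n := P D'_n` consistent conditionals of each
other on the increasing closed events `E n := {range ⊆ closure D'_n}`, and the glued `ν` is the candidate `Q D p`.

Proof. `k ↦ μ k (E n)` is antitone (equal to `1` for `k ≤ n`, then `μ (k+1) (E n) = μ k (E n) * μ (k+1) (E k)`), with limit
`c n`; consistency gives `c n = μ m (E n) * c m` for `n ≤ m`, exhaustion gives `⨆ n, c n = 1`. The set functions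
`T ↦ c n * μ n T` increase with `n` on measurable sets and their supremum `ν` is a measure (monotone convergence for
series, via the counting-measure integral); `ν (T ∩ E n) = c n * μ n T`, so `ν (E n) = c n`, `ν univ = 1`, and `ν` is carried
by `⋃ E n`. Uniqueness: a solution `ν'` has `ν' (E n) = μ m (E n) * ν' (E m) → c n * 1`, hence agrees with `ν` on every
`T ∩ E n`, hence on every measurable `T` by continuity from below along `T ∩ E n ↑ T ∩ ⋃ E`.

* `exists_measure_eq_iSup` — the supremum of a sequence of measures increasing on measurable sets is a measure.
* `gluing_existsUnique` — the statement for `X : Type*`; `stub_gluingConsistentConditionals` — the registered signature.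

References: folklore measure theory (consistent conditional probabilities on an increasing union; cf. O. Kallenberg,
*Foundations of Modern Probability*, 2nd ed. (2002), Ch. 6; P. Billingsley, *Probability and Measure*, 3rd ed. (1995),
§33). All [folklore].
-/

noncomputable section

open MeasureTheory Filter Topology Set
open scoped ENNReal NNReal

namespace Summit.CriticalPhenomena.SAWScalingLimit.Theorems.AxiomsOfLimitMarkov

/-- The supremum of a sequence of measures which increases on measurable sets is a measure: `ν s = ⨆ n, ρ n s` on
measurable `s` (σ-additivity by monotone convergence for series over `ℕ`). [folklore] -/
theorem exists_measure_eq_iSup {X : Type*} [MeasurableSpace X] (ρ : ℕ → Measure X)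
    (hρ : ∀ s, MeasurableSet s → Monotone fun n => ρ n s) :
    ∃ ν : Measure X, ∀ s, MeasurableSet s → ν s = ⨆ n, ρ n s := by
  refine ⟨Measure.ofMeasurable (fun s _ => ⨆ n, ρ n s) (by simp) ?_, fun s hs => Measure.ofMeasurable_apply s hs⟩
  intro f hf hdisj
  simp_rw [measure_iUnion hdisj hf]
  rw [← lintegral_count, lintegral_iSup (fun n => measurable_of_countable _) fun n m hnm i => hρ _ (hf i) hnm]
  simp_rw [lintegral_count]

section Gluing

variable {X : Type*} [MeasurableSpace X] {E : ℕ → Set X} {μ : ℕ → Measure X} {c : ℕ → ℝ≥0∞}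

/-- A probability measure carried by `E k` gives full mass to every later event `E n`, `k ≤ n`. [folklore] -/
theorem measure_event_eq_one (hE : Monotone E) (hEm : ∀ n, MeasurableSet (E n))
    [∀ n, IsProbabilityMeasure (μ n)] (hcar : ∀ n, μ n (E n)ᶜ = 0) {k n : ℕ} (hkn : k ≤ n) :
    μ k (E n) = 1 :=
  le_antisymm prob_le_one
    (((prob_compl_eq_zero_iff (hEm k)).1 (hcar k)).symm.le.trans (measure_mono (hE hkn)))

/-- Consistency along the chain of events: for `n ≤ m ≤ k`, `μ k (E n) = μ m (E n) * μ k (E m)`. [folklore] -/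
theorem measure_event_chain (hE : Monotone E) (hEm : ∀ n, MeasurableSet (E n))
    (hcons : ∀ n m, n ≤ m → ∀ T : Set X, MeasurableSet T → μ n T * μ m (E n) = μ m (T ∩ E n))
    {n m k : ℕ} (hnm : n ≤ m) (hmk : m ≤ k) : μ k (E n) = μ m (E n) * μ k (E m) := by
  rw [hcons m k hmk (E n) (hEm n), inter_eq_left.2 (hE hnm)]

/-- The masses `k ↦ μ k (E n)` are antitone: equal to `1` up to `k = n`, then decreasing by consistency. [folklore] -/
theorem antitone_measure_event (hE : Monotone E) (hEm : ∀ n, MeasurableSet (E n))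
    [∀ n, IsProbabilityMeasure (μ n)] (hcar : ∀ n, μ n (E n)ᶜ = 0)
    (hcons : ∀ n m, n ≤ m → ∀ T : Set X, MeasurableSet T → μ n T * μ m (E n) = μ m (T ∩ E n)) (n : ℕ) :
    Antitone fun k => μ k (E n) := by
  refine antitone_nat_of_succ_le fun k => ?_
  rcases lt_or_ge k n with hk | hk
  · rw [measure_event_eq_one hE hEm hcar hk.le]
    exact prob_le_one
  · rw [measure_event_chain hE hEm hcons hk (Nat.le_succ k)]
    exact mul_le_of_le_one_right' prob_le_one

/-- The masses `k ↦ μ k (E n)` converge, for every `n` (to `c n := ⨅ k, μ k (E n)`). [folklore] -/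
theorem exists_limit_measure_event (hE : Monotone E) (hEm : ∀ n, MeasurableSet (E n))
    [∀ n, IsProbabilityMeasure (μ n)] (hcar : ∀ n, μ n (E n)ᶜ = 0)
    (hcons : ∀ n m, n ≤ m → ∀ T : Set X, MeasurableSet T → μ n T * μ m (E n) = μ m (T ∩ E n)) :
    ∃ c : ℕ → ℝ≥0∞, ∀ n, Tendsto (fun k => μ k (E n)) atTop (𝓝 (c n)) :=
  ⟨fun n => ⨅ k, μ k (E n), fun n => tendsto_atTop_iInf (antitone_measure_event hE hEm hcar hcons n)⟩

/-- The limit identity `c n = μ m (E n) * c m` for `n ≤ m` (pass to the limit `k → ∞` in the chain identity). [folklore] -/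
theorem limit_eq_mul (hE : Monotone E) (hEm : ∀ n, MeasurableSet (E n)) [∀ n, IsProbabilityMeasure (μ n)]
    (hcons : ∀ n m, n ≤ m → ∀ T : Set X, MeasurableSet T → μ n T * μ m (E n) = μ m (T ∩ E n))
    (hc : ∀ n, Tendsto (fun k => μ k (E n)) atTop (𝓝 (c n))) {n m : ℕ} (hnm : n ≤ m) :
    c n = μ m (E n) * c m := by
  have h : (fun k => μ k (E n)) =ᶠ[atTop] fun k => μ m (E n) * μ k (E m) := by
    filter_upwards [eventually_ge_atTop m] with k hk
    exact measure_event_chain hE hEm hcons hnm hk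
  exact tendsto_nhds_unique ((hc n).congr' h) (ENNReal.Tendsto.const_mul (hc m) (Or.inr (measure_ne_top _ _)))

/-- The limits are at most `1`. [folklore] -/
theorem limit_le_one [∀ n, IsProbabilityMeasure (μ n)] (hc : ∀ n, Tendsto (fun k => μ k (E n)) atTop (𝓝 (c n)))
    (n : ℕ) : c n ≤ 1 :=
  le_of_tendsto' (hc n) fun _ => prob_le_one

/-- The key identity `c m * μ m (T ∩ E n) = c n * μ n T` for `n ≤ m` and measurable `T`. [folklore] -/
theorem limit_mul_measure_inter (hE : Monotone E) (hEm : ∀ n, MeasurableSet (E n))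
    [∀ n, IsProbabilityMeasure (μ n)]
    (hcons : ∀ n m, n ≤ m → ∀ T : Set X, MeasurableSet T → μ n T * μ m (E n) = μ m (T ∩ E n))
    (hc : ∀ n, Tendsto (fun k => μ k (E n)) atTop (𝓝 (c n))) {n m : ℕ} (hnm : n ≤ m) {T : Set X}
    (hT : MeasurableSet T) : c m * μ m (T ∩ E n) = c n * μ n T := by
  rw [← hcons n m hnm T hT, limit_eq_mul hE hEm hcons hc hnm]
  ring

/-- The set functions `T ↦ c n * μ n T` increase with `n` on measurable sets. [folklore] -/
theorem monotone_limit_mul_measure (hE : Monotone E) (hEm : ∀ n, MeasurableSet (E n))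
    [∀ n, IsProbabilityMeasure (μ n)]
    (hcons : ∀ n m, n ≤ m → ∀ T : Set X, MeasurableSet T → μ n T * μ m (E n) = μ m (T ∩ E n))
    (hc : ∀ n, Tendsto (fun k => μ k (E n)) atTop (𝓝 (c n))) {T : Set X} (hT : MeasurableSet T) :
    Monotone fun n => c n * μ n T := by
  refine monotone_nat_of_le_succ fun n => ?_
  show c n * μ n T ≤ c (n + 1) * μ (n + 1) T
  rw [← limit_mul_measure_inter hE hEm hcons hc (Nat.le_succ n) hT]
  exact mul_le_mul_right (measure_mono inter_subset_left) _

/-- Evaluation of the supremum on the traces: `⨆ k, c k * μ k (T ∩ E n) = c n * μ n T`. [folklore] -/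
theorem iSup_limit_mul_measure_inter (hE : Monotone E) (hEm : ∀ n, MeasurableSet (E n))
    [∀ n, IsProbabilityMeasure (μ n)]
    (hcons : ∀ n m, n ≤ m → ∀ T : Set X, MeasurableSet T → μ n T * μ m (E n) = μ m (T ∩ E n))
    (hc : ∀ n, Tendsto (fun k => μ k (E n)) atTop (𝓝 (c n))) (n : ℕ) {T : Set X} (hT : MeasurableSet T) :
    ⨆ k, c k * μ k (T ∩ E n) = c n * μ n T := by
  refine le_antisymm (iSup_le fun k => ?_)
    (le_iSup_of_le n (limit_mul_measure_inter hE hEm hcons hc le_rfl hT).ge)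
  rcases le_or_gt n k with hnk | hkn
  · exact (limit_mul_measure_inter hE hEm hcons hc hnk hT).le
  · rw [← limit_mul_measure_inter hE hEm hcons hc hkn.le (hT.inter (hEm n))]
    exact mul_le_mul_right (measure_mono (inter_subset_left.trans inter_subset_left)) _

/-- Exhaustion: `⨆ n, c n = 1`. [folklore] -/
theorem iSup_limit_eq_one [∀ n, IsProbabilityMeasure (μ n)]
    (hc : ∀ n, Tendsto (fun k => μ k (E n)) atTop (𝓝 (c n)))
    (hexh : ∀ ε : ℝ≥0∞, 0 < ε → ∃ n, ∀ m, n ≤ m → 1 - ε ≤ μ m (E n)) : ⨆ n, c n = 1 := by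
  refine le_antisymm (iSup_le fun n => limit_le_one hc n) (ENNReal.le_of_forall_pos_le_add fun ε hε _ => ?_)
  obtain ⟨n, hn⟩ := hexh ε (ENNReal.coe_pos.2 hε)
  have h1 : 1 - (ε : ℝ≥0∞) ≤ c n := ge_of_tendsto (hc n) (eventually_atTop.2 ⟨n, hn⟩)
  calc (1 : ℝ≥0∞) ≤ 1 - ε + ε := le_tsub_add
    _ ≤ c n + ε := by gcongr
    _ ≤ (⨆ n, c n) + ε := by gcongr; exact le_iSup c n

/-- Any solution `ν` (probability, carried by `⋃ E n`, `μ n = ν (· | E n)`) has `ν (E n) = c n`. [folklore] -/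
theorem solution_measure_event (hE : Monotone E) (hEm : ∀ n, MeasurableSet (E n))
    (hc : ∀ n, Tendsto (fun k => μ k (E n)) atTop (𝓝 (c n))) {ν : Measure X} [IsProbabilityMeasure ν]
    (hνcar : ν (⋃ n, E n)ᶜ = 0)
    (hν : ∀ (n : ℕ) (T : Set X), MeasurableSet T → μ n T * ν (E n) = ν (T ∩ E n)) (n : ℕ) :
    ν (E n) = c n := by
  have h1 : Tendsto (fun m => ν (E m)) atTop (𝓝 1) := by
    rw [← (prob_compl_eq_zero_iff (MeasurableSet.iUnion hEm)).1 hνcar]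
    exact tendsto_measure_iUnion_atTop hE
  have h2 : Tendsto (fun m => μ m (E n) * ν (E m)) atTop (𝓝 (c n * 1)) :=
    ENNReal.Tendsto.mul (hc n) (Or.inr ENNReal.one_ne_top) h1 (Or.inl one_ne_zero)
  rw [mul_one] at h2
  have h3 : (fun _ : ℕ => ν (E n)) =ᶠ[atTop] fun m => μ m (E n) * ν (E m) := by
    filter_upwards [eventually_ge_atTop n] with m hm
    rw [hν m (E n) (hEm n), inter_eq_left.2 (hE hm)]
  exact tendsto_nhds_unique (tendsto_const_nhds.congr' h3) h2

/-- Two measures carried by `⋃ E n` which agree on every trace `T ∩ E n` of a measurable `T` are equal (continuity from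
below). [folklore] -/
theorem ext_of_inter_event (hE : Monotone E) {ν ν' : Measure X} (hνcar : ν (⋃ n, E n)ᶜ = 0)
    (hν'car : ν' (⋃ n, E n)ᶜ = 0)
    (h : ∀ (n : ℕ) (T : Set X), MeasurableSet T → ν (T ∩ E n) = ν' (T ∩ E n)) : ν = ν' := by
  refine Measure.ext fun T hT => ?_
  have hmono : Monotone fun n => T ∩ E n := fun a b hab => inter_subset_inter_right _ (hE hab)
  have key : ∀ ρ : Measure X, ρ (⋃ n, E n)ᶜ = 0 → ρ T = ⨆ n, ρ (T ∩ E n) := fun ρ hρ => by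
    rw [← measure_inter_conull hρ, inter_iUnion, hmono.measure_iUnion]
  rw [key ν hνcar, key ν' hν'car]
  exact iSup_congr fun n => h n T hT

/-- **Gluing consistent conditionals.** For an increasing sequence of measurable events `E n` and probability measures
`μ n` carried by `E n` which are consistent conditionals of each other (`μ n T * μ m (E n) = μ m (T ∩ E n)`, `n ≤ m`) and
exhausting (`1 - ε ≤ μ m (E n)` for `m ≥ n ≥ n₀(ε)`), there is a unique probability measure `ν` carried by `⋃ E n` with
`μ n T * ν (E n) = ν (T ∩ E n)` for all `n` and measurable `T`. [folklore] -/
theorem gluing_existsUnique (hE : Monotone E) (hEm : ∀ n, MeasurableSet (E n)) [∀ n, IsProbabilityMeasure (μ n)]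
    (hcar : ∀ n, μ n (E n)ᶜ = 0)
    (hcons : ∀ n m, n ≤ m → ∀ T : Set X, MeasurableSet T → μ n T * μ m (E n) = μ m (T ∩ E n))
    (hexh : ∀ ε : ℝ≥0∞, 0 < ε → ∃ n, ∀ m, n ≤ m → 1 - ε ≤ μ m (E n)) :
    ∃ ν : Measure X, IsProbabilityMeasure ν ∧ ν (⋃ n, E n)ᶜ = 0 ∧
      (∀ (n : ℕ) (T : Set X), MeasurableSet T → μ n T * ν (E n) = ν (T ∩ E n)) ∧
      ∀ ν' : Measure X, IsProbabilityMeasure ν' → ν' (⋃ n, E n)ᶜ = 0 →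
        (∀ (n : ℕ) (T : Set X), MeasurableSet T → μ n T * ν' (E n) = ν' (T ∩ E n)) → ν' = ν := by
  obtain ⟨c, hc⟩ := exists_limit_measure_event hE hEm hcar hcons
  obtain ⟨ν, hν⟩ := exists_measure_eq_iSup (fun n => c n • μ n) fun s hs => by
    simpa only [Measure.smul_apply, smul_eq_mul] using monotone_limit_mul_measure hE hEm hcons hc hs
  simp only [Measure.smul_apply, smul_eq_mul] at hν
  have hνinter : ∀ (n : ℕ) (T : Set X), MeasurableSet T → ν (T ∩ E n) = c n * μ n T := fun n T hT => by
    rw [hν _ (hT.inter (hEm n)), iSup_limit_mul_measure_inter hE hEm hcons hc n hT]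
  have hνE : ∀ n, ν (E n) = c n := fun n => by simpa using hνinter n univ MeasurableSet.univ
  have hνid : ∀ (n : ℕ) (T : Set X), MeasurableSet T → μ n T * ν (E n) = ν (T ∩ E n) := fun n T hT => by
    rw [hνE, hνinter n T hT, mul_comm]
  have hνprob : IsProbabilityMeasure ν :=
    ⟨by simpa [iSup_limit_eq_one hc hexh] using hν univ MeasurableSet.univ⟩
  have hνcar : ν (⋃ n, E n)ᶜ = 0 := by
    rw [hν _ (MeasurableSet.iUnion hEm).compl, ENNReal.iSup_eq_zero]
    intro n
    rw [measure_mono_null (compl_subset_compl.2 (subset_iUnion E n)) (hcar n), mul_zero]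
  refine ⟨ν, hνprob, hνcar, hνid, fun ν' hν'prob hν'car hν'id => ?_⟩
  refine ext_of_inter_event hE hν'car hνcar fun n T hT => ?_
  rw [← hν'id n T hT, ← hνid n T hT, solution_measure_event hE hEm hc hν'car hν'id n,
    solution_measure_event hE hEm hc hνcar hνid n]

end Gluing

/-- **Registered sub-goal `stub_gluingConsistentConditionals`** (crux stmt-CriticalPhenomena-1370, restriction-built kernel,
brick 1): `gluing_existsUnique` with all binders explicit, notation-free — consistent conditionals on an exhausting
increasing family of events determine a unique probability measure. [folklore] -/
theorem stub_gluingConsistentConditionals : ∀ (X : Type) [MeasurableSpace X] (E : ℕ → Set X), Monotone E → (∀ n, MeasurableSet (E n)) → ∀ (μ : ℕ → MeasureTheory.Measure X), (∀ n, MeasureTheory.IsProbabilityMeasure (μ n)) → (∀ n, μ n (E n)ᶜ = 0) → (∀ n m, n ≤ m → ∀ T : Set X, MeasurableSet T → μ n T * μ m (E n) = μ m (T ∩ E n)) → (∀ ε : ENNReal, 0 < ε → ∃ n, ∀ m, n ≤ m → 1 - ε ≤ μ m (E n)) → ∃ ν : MeasureTheory.Measure X, MeasureTheory.IsProbabilityMeasure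 ν ∧ ν (⋃ n, E n)ᶜ = 0 ∧ (∀ (n : ℕ) (T : Set X), MeasurableSet T → μ n T * ν (E n) = ν (T ∩ E n)) ∧ ∀ ν' : MeasureTheory.Measure X, MeasureTheory.IsProbabilityMeasure ν' → ν' (⋃ n, E n)ᶜ = 0 → (∀ (n : ℕ) (T : Set X), MeasurableSet T → μ n T * ν' (E n) = ν' (T ∩ E n)) → ν' = ν :=
  fun _ _ _ hE hEm _ _ hcar hcons hexh => gluing_existsUnique hE hEm hcar hcons hexh

end Summit.CriticalPhenomena.SAWScalingLimit.Theorems.AxiomsOfLimitMarkov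

end
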